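/-
HONEST FRAMING: certified error envelopes and provably optimal rounding/accumulation schemes for
low-precision formats under stated cost models; every table by two implementations; no hardware
or vendor claims.
-/
import Summits.Ventures.CertifiedArithmetic.LowPrec.OptDemotionRoutingConeVec

/-!
# The demotion law (Theorem T8), part 9b: the CONE-CLOSURE PRINCIPLE and its certificate checker

opt gen 14 (C36/C37, `certs/opt/closure_q4.json`, `closure_q5_min.json`) proves the two-tree
inequality `TT q` (part 8l) at `q = 4, 5` by a CONE-CLOSURE CERTIFICATE: integer rows `r`
(functionals `v ↦ Σ_i r_i v_i` on tables `v : ℕ → ℚ` = the routing values `BR_t` on the `2^(q-1)`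
mantissas of the top binade) whose cone `K = {v ≥ 0 : dot r v ≤ 0 ∀ r}` contains the leaf table `0`
and is closed under the NODE MAP `N(a, b)_i = 2^(q-1) + Ĥ_i(a, b) / 2^q`,
`Ĥ_i(a, b) = max(0, max over the bit splits s of mantissa i of partEval s.1 a + partEval s.2 b)`.
THIS FILE is the abstract half: the node map on tables given SPLIT DATA (`Part`, `splitEval`,
`hHat`, `nodeMap`), the certificate format (`Con`, `CTree`: per row, a tree branching over the
splits of its positive coordinates whose leaves carry nonnegative integer multipliers of
rows-applied-to-a-child and of "split ≤ node maximum" constraints), the Boolean checker `rowCheck`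
(pure `List ℤ` arithmetic, run by `decide +kernel` in parts 9e ff.), and its SOUNDNESS
`inCone_nodeMap` (`a, b ∈ K ⟹ N(a, b) ∈ K`; weak LP duality made explicit: `leaf_sound`,
`go_sound`).  Part 9c identifies `N` with the node rule of `treeBR` (part 8a).
-/

namespace Summit.Ventures.CertifiedArithmetic.LowPrec.Opt.Cone

/-! ## Parts, splits and the abstract node map -/

/-- A PART of a bit split, read on a child's table: `none` is the empty part (value `0`);
`some (i, L)` reads mantissa `i` (value `2^(q-1) + i`) `q - L` binades down, i.e. the part's value
is `2^L (2^(q-1) + i) / 2^q` and its routing value is `2^L · v_i / 2^q` (homogeneity of `BR`). -/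
abbrev Part := Option (ℕ × ℕ)

/-- The `2^q`-scaled reading of a part on a table: `2^L · v_i` (`0` for the empty part). -/
def partEval : Part → (ℕ → ℚ) → ℚ
  | none, _ => 0
  | some (i, L), v => 2 ^ L * v i

/-- Parts read nonnegative tables nonnegatively. -/
theorem partEval_nonneg (p : Part) {v : ℕ → ℚ} (hv : ∀ i, 0 ≤ v i) : 0 ≤ partEval p v := by
  rcases p with _ | ⟨i, L⟩
  · simp [partEval]
  · simp only [partEval]; exact mul_nonneg (by positivity) (hv i)

/-- The `2^q`-scaled value of a split `(A-part, B-part)` on the children's tables. -/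
def splitEval (s : Part × Part) (a b : ℕ → ℚ) : ℚ := partEval s.1 a + partEval s.2 b

/-- Splits read nonnegative tables nonnegatively. -/
theorem splitEval_nonneg (s : Part × Part) {a b : ℕ → ℚ} (ha : ∀ i, 0 ≤ a i) (hb : ∀ i, 0 ≤ b i) :
    0 ≤ splitEval s a b :=
  add_nonneg (partEval_nonneg s.1 ha) (partEval_nonneg s.2 hb)

/-- `max (0, max of a list)`. -/
def foldMax : List ℚ → ℚ
  | [] => 0
  | x :: xs => max x (foldMax xs)

/-- `foldMax ≥ 0`. -/
theorem foldMax_nonneg : ∀ l : List ℚ, 0 ≤ foldMax l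
  | [] => le_rfl
  | _ :: xs => le_max_of_le_right (foldMax_nonneg xs)

/-- Members are dominated. -/
theorem le_foldMax_of_mem : ∀ {l : List ℚ} {x : ℚ}, x ∈ l → x ≤ foldMax l
  | [], _, h => absurd h List.not_mem_nil
  | y :: _, x, h => by
      rcases List.mem_cons.1 h with rfl | h
      · exact le_max_left _ _
      · exact le_max_of_le_right (le_foldMax_of_mem h)

/-- A nonnegative bound on all members bounds `foldMax`. -/
theorem foldMax_le : ∀ {l : List ℚ} {c : ℚ}, 0 ≤ c → (∀ x ∈ l, x ≤ c) → foldMax l ≤ c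
  | [], _, hc, _ => hc
  | y :: _, _, hc, h =>
      max_le (h y List.mem_cons_self) (foldMax_le hc fun x hx => h x (List.mem_cons_of_mem y hx))

/-- `foldMax` is `0` or attained. -/
theorem foldMax_eq_zero_or_mem : ∀ l : List ℚ, foldMax l = 0 ∨ foldMax l ∈ l
  | [] => Or.inl rfl
  | y :: ys => by
      simp only [foldMax]
      rcases le_total y (foldMax ys) with h | h
      · rw [max_eq_right h]
        exact (foldMax_eq_zero_or_mem ys).imp id fun hm => List.mem_cons_of_mem y hm
      · rw [max_eq_left h]; exact Or.inr List.mem_cons_self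

/-- `Ĥ_d(a, b)`: the best split of the list `d` read on the children `(a, b)` (`2^q`-scaled), or `0`. -/
def hHat (d : List (Part × Part)) (a b : ℕ → ℚ) : ℚ := foldMax (d.map fun s => splitEval s a b)

/-- `Ĥ ≥ 0`. -/
theorem hHat_nonneg (d : List (Part × Part)) (a b : ℕ → ℚ) : 0 ≤ hHat d a b := foldMax_nonneg _

/-- Every listed split is dominated by `Ĥ`. -/
theorem splitEval_le_hHat {d : List (Part × Part)} {s : Part × Part} (hs : s ∈ d) (a b : ℕ → ℚ) :
    splitEval s a b ≤ hHat d a b :=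
  le_foldMax_of_mem (List.mem_map.2 ⟨s, hs, rfl⟩)

/-- THE ABSTRACT NODE MAP on tables given split data (one split list per mantissa):
`N(a, b)_i = 2^(q-1) + Ĥ_i(a, b) / 2^q`. -/
def nodeMap (q : ℕ) (data : List (List (Part × Part))) (a b : ℕ → ℚ) (i : ℕ) : ℚ :=
  2 ^ (q - 1) + hHat (data.getD i []) a b / 2 ^ q

/-- The table of node maxima `i ↦ Ĥ_i(a, b)`. -/
def hTab (data : List (List (Part × Part))) (a b : ℕ → ℚ) : ℕ → ℚ := fun i => hHat (data.getD i []) a b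

/-- `Ĥ_i ≥ 0`. -/
theorem hTab_nonneg (data : List (List (Part × Part))) (a b : ℕ → ℚ) (i : ℕ) : 0 ≤ hTab data a b i :=
  hHat_nonneg _ a b

/-- The coefficient vector of a part (`2^L` at index `i`). -/
def pvec : Part → List ℤ
  | none => []
  | some (i, L) => unitV i (2 ^ L)

/-- `pvec` represents `partEval`. -/
theorem dot_pvec (p : Part) (v : ℕ → ℚ) : dot (pvec p) v = partEval p v := by
  rcases p with _ | ⟨i, L⟩
  · simp [pvec, partEval]
  · simp [pvec, partEval, dot_unitV]

/-! ## The cone, the certificate format and the checker -/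

/-- MEMBERSHIP IN THE CONE of the rows: nonnegative and every row functional `≤ 0`. -/
def InCone (rows : List (List ℤ)) (v : ℕ → ℚ) : Prop := (∀ i, 0 ≤ v i) ∧ ∀ r ∈ rows, dot r v ≤ 0

/-- A CONSTRAINT with its nonnegative integer multiplier `y`: `ka k y` / `kb k y` = row `k` applied
to child `a` / `b` (`≤ 0` on the cone); `phi j n y` = "split number `n` of mantissa `j` is at most
the node maximum `Ĥ_j`". -/
inductive Con : Type
  | ka (k y : ℕ)
  | kb (k y : ℕ)
  | phi (j n y : ℕ)

/-- A CERTIFICATE TREE for one row: `br` branches over the split list of the next positive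
coordinate (one subtree per split, in order); a leaf `lf D cs` carries the positive scale `D` of the
objective and the constraints `cs`. -/
inductive CTree : Type
  | lf (D : ℕ) (cs : List Con)
  | br (ts : List CTree)

/-- Accumulated coefficient vectors of a leaf's constraints: on child `a`, on child `b`, and the
total `phi`-weight per mantissa. -/
structure Acc3 where
  /-- coefficients on the table of child `a` -/
  sa : List ℤ
  /-- coefficients on the table of child `b` -/
  sb : List ℤ
  /-- total multiplier of the `phi` constraints of each mantissa -/
  ny : List ℤ

/-- Adding one constraint to the accumulators. -/
def conAcc (rows : List (List ℤ)) (data : List (List (Part × Part))) : Con → Acc3 → Acc3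
  | .ka k y, acc => { acc with sa := addV (smulV y (rows.getD k [])) acc.sa }
  | .kb k y, acc => { acc with sb := addV (smulV y (rows.getD k [])) acc.sb }
  | .phi j n y, acc =>
      let s := (data.getD j []).getD n (none, none)
      { sa := addV (smulV y (pvec s.1)) acc.sa
        sb := addV (smulV y (pvec s.2)) acc.sb
        ny := addV (unitV j y) acc.ny }

/-- The accumulators of a constraint list. -/
def leafAcc (rows : List (List ℤ)) (data : List (List (Part × Part))) (cs : List Con) : Acc3 :=
  cs.foldr (conAcc rows data) ⟨[], [], []⟩

/-- THE LEAF TEST: `D > 0`, `D · accA ≤ Σ (constraint vectors on a)`, the same on `b`, and the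
`phi`-weight of each mantissa `j` is at most `D · (-r_j)⁺`. -/
def leafCheck (rows : List (List ℤ)) (data : List (List (Part × Part))) (r accA accB : List ℤ)
    (D : ℕ) (cs : List Con) : Bool :=
  let acc := leafAcc rows data cs
  decide (0 < D) && (leV (smulV D accA) acc.sa && (leV (smulV D accB) acc.sb &&
    leV acc.ny (smulV D (negPart r))))

/-- THE ROW WALK: over the remaining coefficients `rest` of the row (current mantissa `i`), branch on
every split of a positive coordinate (adding `c ·` the split's vectors to the objective
accumulators), skip the others, and test the leaf at the end. -/
def go (rows : List (List ℤ)) (data : List (List (Part × Part))) (r : List ℤ) :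
    List ℤ → ℕ → List ℤ → List ℤ → CTree → Bool
  | [], _, accA, accB, .lf D cs => leafCheck rows data r accA accB D cs
  | [], _, _, _, .br _ => false
  | c :: rest, i, accA, accB, .lf D cs =>
      if 0 < c then false else go rows data r rest (i + 1) accA accB (.lf D cs)
  | c :: rest, i, accA, accB, .br ts =>
      if 0 < c then
        !(data.getD i []).isEmpty && (ts.length == (data.getD i []).length &&
          ((data.getD i []).zip ts).all fun p =>
            go rows data r rest (i + 1) (addV accA (smulV c (pvec p.1.1)))
              (addV accB (smulV c (pvec p.1.2))) p.2)
      else go rows data r rest (i + 1) accA accB (.br ts)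

/-- THE ROW TEST: the row has at most `2^(q-1)` coefficients, coefficient sum `≤ 0` (the one-node
table), and its certificate tree passes the walk. -/
def rowCheck (q : ℕ) (rows : List (List ℤ)) (data : List (List (Part × Part))) (r : List ℤ)
    (t : CTree) : Bool :=
  decide (r.length ≤ 2 ^ (q - 1)) && (decide (r.sum ≤ 0) && go rows data r r 0 [] [] t)

/-! ## Soundness -/

section Sound

variable {rows : List (List ℤ)} {data : List (List (Part × Part))} {a b : ℕ → ℚ}

/-- The value of a constraint's combination on `(a, b)`. -/
def conVal (rows : List (List ℤ)) (data : List (List (Part × Part))) (a b : ℕ → ℚ) : Con → ℚ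
  | .ka k y => ((y : ℤ) : ℚ) * dot (rows.getD k []) a
  | .kb k y => ((y : ℤ) : ℚ) * dot (rows.getD k []) b
  | .phi j n y => ((y : ℤ) : ℚ) * splitEval ((data.getD j []).getD n (none, none)) a b

/-- The `phi`-weight of a constraint times its node maximum. -/
def conNy (data : List (List (Part × Part))) (a b : ℕ → ℚ) : Con → ℚ
  | .ka _ _ => 0
  | .kb _ _ => 0
  | .phi j _ y => ((y : ℤ) : ℚ) * hTab data a b j

/-- What the accumulators compute. -/
theorem leafAcc_spec : ∀ cs : List Con,
    dot (leafAcc rows data cs).sa a + dot (leafAcc rows data cs).sb b =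
        (cs.map (conVal rows data a b)).sum ∧
      dot (leafAcc rows data cs).ny (hTab data a b) = (cs.map (conNy data a b)).sum
  | [] => by simp [leafAcc]
  | c :: cs => by
      obtain ⟨ih1, ih2⟩ := leafAcc_spec cs
      have e : leafAcc rows data (c :: cs) = conAcc rows data c (leafAcc rows data cs) := rfl
      rw [e]
      cases c with
      | ka k y =>
          simp only [conAcc, List.map_cons, List.sum_cons, conVal, conNy]
          rw [dot_addV, dot_smulV, ← ih1, ih2]
          exact ⟨by ring, by ring⟩
      | kb k y =>
          simp only [conAcc, List.map_cons, List.sum_cons, conVal, conNy]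
          rw [dot_addV, dot_smulV, ← ih1, ih2]
          exact ⟨by ring, by ring⟩
      | phi j n y =>
          simp only [conAcc, List.map_cons, List.sum_cons, conVal, conNy, splitEval]
          rw [dot_addV, dot_addV, dot_addV, dot_smulV, dot_smulV, dot_pvec, dot_pvec, dot_unitV,
            ← ih2]
          refine ⟨?_, by ring⟩
          rw [← ih1]; ring

/-- A row of the list, or the empty functional, is `≤ 0` on the cone. -/
theorem dot_getD_nonpos {v : ℕ → ℚ} (hv : InCone rows v) (k : ℕ) : dot (rows.getD k []) v ≤ 0 := by
  rw [List.getD_eq_getElem?_getD]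
  cases h : rows[k]? with
  | none => simp
  | some r => simpa using hv.2 r (List.mem_of_getElem? h)

/-- Each constraint is `≤` its `phi`-weight term on the cone. -/
theorem conVal_le_conNy (ha : InCone rows a) (hb : InCone rows b) (c : Con) :
    conVal rows data a b c ≤ conNy data a b c := by
  cases c with
  | ka k y =>
      simp only [conVal, conNy]
      exact mul_nonpos_of_nonneg_of_nonpos (by positivity) (dot_getD_nonpos ha k)
  | kb k y =>
      simp only [conVal, conNy]
      exact mul_nonpos_of_nonneg_of_nonpos (by positivity) (dot_getD_nonpos hb k)
  | phi j n y =>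
      simp only [conVal, conNy]
      refine mul_le_mul_of_nonneg_left ?_ (by positivity)
      rw [List.getD_eq_getElem?_getD]
      cases h : (data.getD j [])[n]? with
      | none =>
          simp only [Option.getD_none, splitEval, partEval, add_zero]
          exact hTab_nonneg data a b j
      | some s =>
          simp only [Option.getD_some]
          exact splitEval_le_hHat (List.mem_of_getElem? h) a b

/-- Summing `conVal ≤ conNy` over a constraint list. -/
theorem sum_conVal_le (ha : InCone rows a) (hb : InCone rows b) : ∀ cs : List Con,
    (cs.map (conVal rows data a b)).sum ≤ (cs.map (conNy data a b)).sum
  | [] => by simp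
  | c :: cs => by
      simp only [List.map_cons, List.sum_cons]
      exact add_le_add (conVal_le_conNy ha hb c) (sum_conVal_le ha hb cs)

/-- SOUNDNESS OF THE LEAF TEST: `accA · a + accB · b + Σ_{r_j < 0} r_j Ĥ_j(a, b) ≤ 0` on the cone. -/
theorem leaf_sound (ha : InCone rows a) (hb : InCone rows b) {r accA accB : List ℤ} {D : ℕ}
    {cs : List Con} (h : leafCheck rows data r accA accB D cs = true) :
    dot accA a + dot accB b + dotNeg r (hTab data a b) ≤ 0 := by
  simp only [leafCheck, Bool.and_eq_true, decide_eq_true_eq] at h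
  obtain ⟨hD, h1, h2, h3⟩ := h
  have hDq : (0 : ℚ) < D := by exact_mod_cast hD
  have e1 := dot_le_of_leV _ _ a h1 ha.1
  have e2 := dot_le_of_leV _ _ b h2 hb.1
  have e3 := dot_le_of_leV _ _ (hTab data a b) h3 (hTab_nonneg data a b)
  rw [dot_smulV] at e1 e2 e3
  obtain ⟨s1, s2⟩ := leafAcc_spec (rows := rows) (data := data) (a := a) (b := b) cs
  have s3 := sum_conVal_le (data := data) ha hb cs
  rw [dotNeg_eq_neg_dot_negPart]
  push_cast at e1 e2 e3
  have e : (D : ℚ) * (dot accA a + dot accB b + -dot (negPart r) (hTab data a b)) =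
      (D : ℚ) * dot accA a + (D : ℚ) * dot accB b - (D : ℚ) * dot (negPart r) (hTab data a b) := by
    ring
  exact le_of_mul_le_mul_left (by rw [e, mul_zero]; linarith) hDq

/-- A member of a nonempty zip by index. -/
theorem getElem_pair_mem_zip {α β : Type} {d : List α} {ts : List β} {n : ℕ} (hn : n < d.length)
    (hn' : n < ts.length) : (d[n], ts[n]) ∈ d.zip ts := by
  have hz : n < (d.zip ts).length := by rw [List.length_zip]; exact lt_min hn hn'
  rw [← List.getElem_zip (l := d) (l' := ts) (i := n) (h := hz)]
  exact List.getElem_mem hz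

/-- SOUNDNESS OF THE ROW WALK:
`accA · a + accB · b + Σ_{rest_j > 0} rest_j Ĥ_{i+j} + Σ_{r_j < 0} r_j Ĥ_j ≤ 0` on the cone. -/
theorem go_sound (ha : InCone rows a) (hb : InCone rows b) (r : List ℤ) :
    ∀ (rest : List ℤ) (i : ℕ) (accA accB : List ℤ) (t : CTree),
      go rows data r rest i accA accB t = true →
        dot accA a + dot accB b + dotPos rest (fun j => hTab data a b (i + j)) +
          dotNeg r (hTab data a b) ≤ 0
  | [], i, accA, accB, .lf D cs, h => by
      rw [dotPos_nil, add_zero]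
      exact leaf_sound ha hb (by simpa [go] using h)
  | [], i, accA, accB, .br ts, h => by simp [go] at h
  | c :: rest, i, accA, accB, t, h => by
      have eidx : (fun j => hTab data a b (i + (j + 1))) = fun j => hTab data a b (i + 1 + j) := by
        funext j; congr 1; omega
      simp only [dotPos_cons, add_zero]
      rw [eidx]
      by_cases hc : 0 < c
      · rw [if_pos hc]
        cases t with
        | lf D cs => simp [go, hc] at h
        | br ts =>
            simp only [go, if_pos hc, Bool.and_eq_true, Bool.not_eq_true', List.isEmpty_eq_false_iff,
              beq_iff_eq] at h
            obtain ⟨hne, hlen, hall⟩ := h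
            set d := data.getD i [] with hd
            have hH : hTab data a b i = hHat d a b := by simp [hTab, hd]
            have hc0 : (0 : ℚ) ≤ c := by exact_mod_cast hc.le
            -- an index `n` of a split with `c Ĥ_i ≤ c · splitEval d[n]`
            have main : ∃ n : ℕ, ∃ hn : n < d.length,
                (c : ℚ) * hTab data a b i ≤ (c : ℚ) * splitEval d[n] a b := by
              rcases foldMax_eq_zero_or_mem (d.map fun s => splitEval s a b) with h0 | hm
              · obtain ⟨s, hs⟩ := List.exists_mem_of_ne_nil d hne
                obtain ⟨n, hn, rfl⟩ := List.getElem_of_mem hs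
                refine ⟨n, hn, ?_⟩
                rw [hH, hHat, h0, mul_zero]
                exact mul_nonneg hc0 (splitEval_nonneg _ ha.1 hb.1)
              · obtain ⟨s, hs, hval⟩ := List.mem_map.1 hm
                obtain ⟨n, hn, rfl⟩ := List.getElem_of_mem hs
                refine ⟨n, hn, le_of_eq ?_⟩
                rw [hH, hHat, ← hval]
            obtain ⟨n, hn, hle⟩ := main
            have hn' : n < ts.length := by rw [hlen]; exact hn
            have hgo := List.all_eq_true.1 hall _ (getElem_pair_mem_zip hn hn')
            have ih := go_sound ha hb r rest (i + 1) _ _ _ hgo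
            rw [dot_addV, dot_addV, dot_smulV, dot_smulV, dot_pvec, dot_pvec] at ih
            simp only [splitEval] at hle
            linarith
      · rw [if_neg hc]
        cases t with
        | lf D cs =>
            simp only [go, if_neg hc] at h
            have ih := go_sound ha hb r rest (i + 1) _ _ _ h
            linarith
        | br ts =>
            simp only [go, if_neg hc] at h
            have ih := go_sound ha hb r rest (i + 1) _ _ _ h
            linarith

/-- The row functional on the node maxima is `≤ 0` on the cone. -/
theorem dot_hTab_nonpos (ha : InCone rows a) (hb : InCone rows b) {r : List ℤ} {t : CTree}
    (h : go rows data r r 0 [] [] t = true) : dot r (hTab data a b) ≤ 0 := by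
  have := go_sound ha hb r r 0 [] [] t h
  have e : (fun j => hTab data a b (0 + j)) = hTab data a b := by funext j; rw [zero_add]
  rw [dot_nil, dot_nil, e] at this
  rw [dot_eq_dotPos_add_dotNeg]
  linarith

/-- **THE CONE-CLOSURE STEP.** If every row has a passing certificate tree, the cone is closed
under the abstract node map: `a, b ∈ K ⟹ N(a, b) ∈ K`. -/
theorem inCone_nodeMap {q : ℕ} (hrows : ∀ r ∈ rows, ∃ t, rowCheck q rows data r t = true)
    (ha : InCone rows a) (hb : InCone rows b) : InCone rows (nodeMap q data a b) := by
  refine ⟨fun i => add_nonneg (by positivity) (div_nonneg (hHat_nonneg _ a b) (by positivity)),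
    fun r hr => ?_⟩
  obtain ⟨t, ht⟩ := hrows r hr
  simp only [rowCheck, Bool.and_eq_true, decide_eq_true_eq] at ht
  obtain ⟨-, hsum, hgo⟩ := ht
  have h1 := dot_hTab_nonpos (data := data) ha hb hgo
  have e : nodeMap q data a b = fun i => (fun _ => (2 : ℚ) ^ (q - 1)) i +
      (fun i => (1 / 2 ^ q) * hTab data a b i) i := by
    funext i; simp only [nodeMap, hTab]; ring
  rw [e, dot_add_fun, dot_const, dot_mul_fun]
  have hs : ((r.sum : ℤ) : ℚ) ≤ 0 := by exact_mod_cast hsum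
  have h2 : (2 : ℚ) ^ (q - 1) * ((r.sum : ℤ) : ℚ) ≤ 0 :=
    mul_nonpos_of_nonneg_of_nonpos (by positivity) hs
  have h3 : (1 / 2 ^ q : ℚ) * dot r (hTab data a b) ≤ 0 :=
    mul_nonpos_of_nonneg_of_nonpos (by positivity) h1
  linarith

/-- The leaf table `0` is in every cone. -/
theorem inCone_zero (rows : List (List ℤ)) : InCone rows fun _ => 0 :=
  ⟨fun _ => le_rfl, fun r _ => by rw [dot_const]; simp⟩

end Sound

end Summit.Ventures.CertifiedArithmetic.LowPrec.Opt.Cone
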